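import Literature.MathematicalPhysics.QuantumFieldTheory.Balaban1983to89.B9Thm313WholeL2G

/-!
# `Balaban1983to89.B9Thm313WholeL2GZ` — [B9] Theorem 3.13 (p. 426): the (3.46) block-L² lines of 𝔊 = 𝔓G₁ with the COARSE-SIDE block-L² letters
# RE-WEIGHTED (Z-twin of `B9Thm313WholeL2G`; R1-cls extended to the (3.46) line — repair of the located «C-LETTER-L2-FLAT», the L² face of
# n06-h's «C-LETTER-FLAT-AT-ONE»)

T. Bałaban, *Propagators for lattice gauge theories in a background field*, Commun. Math. Phys. **99** (1985) 389–434
[`Balaban1985BackgroundPropagators`, "B9"]; [4] = T. Bałaban, *Propagators and renormalization transformations for lattice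
gauge theories. II*, Commun. Math. Phys. **96** (1984) 223–250 [`Balaban1984PropagatorsII`].  statement-level skeleton of published
theorems with citation tags; proofs where landed; nothing here is a claim about the Yang–Mills mass gap.

THE POINT.  `B9Thm313WholeL2G.Letters313L2` reads Q, Q\*-words and C₁ = (QG₁Q\*)⁻¹ through UNWEIGHTED coarse block-L² classes with the printed scale
factors; at the knit's flat pins (QG₁Q\*)⁻¹ alone carries the block count n = L^{jD} (at U = 1, y = y′ = an index bond b: ‖1_b C₁(1) e_b‖₂ ≥
⟪e_b, EE e_b⟫ ≥ n∕(A′·len(b)²) vs the letter's B₄·len(b)⁻² — no member-uniform B₄), exactly as for the sup letters.  Only the products are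
convention-free; so the Z-side block-L² classes get ONE free positive weight `vZ` (the knit pins `vZ := n^{−1∕2}`): `Letters313L2Z … vZ hvZ U`
(`gQs ∕ lapGQs ∕ dGQs ∕ c1 ∕ q` re-weighted, the rest verbatim) and the three lines ★ `GG_l2bd_entry4Z ∕ entry3Z ∕ entry5Z` —
SAME conclusions and constants `constG46 (constKp …) c`; proofs verbatim but for the Z-side weights `vZ·len`, `(vZ·len)⁻¹` in the
`entry_l2w_of_step` ∕ `hasMaj_l2w_of_blockBd_ratio` bookkeeping (all cutting costs 1).  `vZ ≡ 1` recovers the flat statements.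

HONEST SCOPE.  Nothing of print is asserted: every analytic input is a HYPOTHESIS of printed ∕ md shape; kernel-checked bookkeeping.  NOT a node discharge,
NOT summit progress; one finite lattice at a time; nothing continuum, nothing about the mass gap.  Cell `pub-ymgap` (HUMAN RULING D-0062), Track A node
N06 [B9], N06-ASSIGNMENT v1 row 21 (bundle F7), seat `pub-ymgap-dag-n06-l` (g14), 2026-08-27.  NEW file; nothing landed is modified.
-/

namespace Literature.MathematicalPhysics.QuantumFieldTheory.Balaban1983to89.B9Thm313WholeL2GZ

open Literature.MathematicalPhysics.QuantumFieldTheory.Balaban1983to89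
open Finset B6RandomWalk B6RandomWalkHom B9Thm34Ext B9Thm37GlueCor36 B11SectG B9SectDSup B9SectDL2Decay
open B9Thm37AllNorms B9Thm37AllNormsInstances B9Thm312Whole B9Thm312WholeLeaf B9Thm312WholeLeft B9Thm313Whole B9Thm313WholeLeft B9Ineq347
open B9Thm312WholeClasses B9Thm312WholeL2 B9Thm313WholeHolder B9Thm313WholeL2G

noncomputable section

section L2G

variable {g : B9.Geometry} {B : B9.Backgrounds} {X Y Z W : Type} [Fintype X] [Fintype Y] [Fintype Z] [Fintype W]
  [Fintype g.Site]
variable {R₀ : ℝ} {H₀ : Prop}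

/-! ## §1 The block-L² letters, coarse side re-weighted (printed shape; nothing asserted) -/

/-- **THE BLOCK-L² LETTERS OF THEOREM 3.13's REDUCTION AT U, COARSE SIDE RE-WEIGHTED** (`B9Thm313WholeL2G.Letters313L2` with the Z-side block-L²
classes carrying one free positive weight `vZ` — every `len` attached to a COARSE block index is replaced by `vZ·len`: `gQs ∕ lapGQs ∕ dGQs` (source y′ ∈ Z),
`c1` (both), `q` (target y ∈ Z); the knit pins `vZ := n^{−1∕2}`, print's ℓ²-normalisation of Q, Q\*, (QG₁Q\*)⁻¹; `vZ ≡ 1` is the old schema) — (p. 426: *"The formulas (3.147), (3.153) permit us to reduce properties of the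
operators 𝔓, 𝔊 to the corresponding properties of the operators G′, (Q′G′²Q′*)⁻¹, G₁, (QG₁Q*)⁻¹"*), as block-L² bounds
‖1_{Δ(y)}T1_{Δ(y′)}‖₂→₂ ≦ B₄·(scale factors)·e^{−δd(y,y′)} in the convention of (3.46) with the scale powers split between y and y′ (p. 398
remark): `gDv`, `lapGDv`, `dGDv` — G₀D, Δ_UG₀D, ∇_UG₀D with the gauge-mode derivative D of DRD* ([4] (2.26); factors Lʲη, (Lʲη)⁻¹, 1);
`gQs`, `lapGQs`, `dGQs` — G₀Q*, Δ_UG₀Q*, ∇_UG₀Q* (the H₀-type entries of (3.126); factors LʲηL^{j′}η, L^{j′}η∕Lʲη, L^{j′}η); `rgdI`, `rgdDs`,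
`rgdLap` — RD*G₁𝒳 = RG′D*𝒳 ((3.152); Theorem 3.1 for G′ and (3.49) for R) for 𝒳 = I, ∇*_U, Δ_U (factors L^{j′}η, 1, (L^{j′}η)⁻¹); `c1` —
C₁ = (QG₁Q*)⁻¹ with (3.132) (factor (Lʲη)⁻¹(L^{j′}η)⁻¹); `q` — the local averaging operator Q (dimensionless, split Lʲη∕L^{j′}η).
NOTHING ASSERTED: these are the instance's (Theorem 3.1, (3.49), (3.126), (3.132), (3.152)).
[cite: Balaban1985BackgroundPropagators, Thm 3.13 p.426 + (3.152)–(3.153) p.426 + (3.132) p.422 + (3.126) p.420 + (3.46) p.398 + p.398 (remark after (3.47)); Balaban1984PropagatorsII, (2.26) p.228] -/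
structure Letters313L2Z (𝔬 : Ops g B X Y Z W) (Lap : B.Cfg → Module.End ℝ (X → ℝ)) (R₀ : ℝ) (H₀ : Prop) (B₄ δ : ℝ)
    (vZ : g.Site → ℝ) (hvZ : ∀ y, 0 < vZ y) (U : B.Cfg) : Prop where
  gDv : BlockBd (g := toB6 g R₀ H₀) 𝔬.blkW 𝔬.blk (𝔬.G0 U ∘ₗ 𝔬.Dv U)
    (fun (y y' : g.Site) => B₄ * g.len y * Real.exp (-(δ * g.dist y y')))
  lapGDv : BlockBd (g := toB6 g R₀ H₀) 𝔬.blkW 𝔬.blk (Lap U ∘ₗ 𝔬.G0 U ∘ₗ 𝔬.Dv U)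
    (fun (y y' : g.Site) => B₄ * (g.len y)⁻¹ * Real.exp (-(δ * g.dist y y')))
  dGDv : BlockBd (g := toB6 g R₀ H₀) 𝔬.blkW 𝔬.blkY (𝔬.D U ∘ₗ 𝔬.G0 U ∘ₗ 𝔬.Dv U)
    (fun (y y' : g.Site) => B₄ * Real.exp (-(δ * g.dist y y')))
  gQs : BlockBd (g := toB6 g R₀ H₀) 𝔬.blkZ 𝔬.blk (𝔬.G0 U ∘ₗ 𝔬.Qstar U)
    (fun (y y' : g.Site) => B₄ * g.len y * (vZ y' * g.len y') * Real.exp (-(δ * g.dist y y')))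
  lapGQs : BlockBd (g := toB6 g R₀ H₀) 𝔬.blkZ 𝔬.blk (Lap U ∘ₗ 𝔬.G0 U ∘ₗ 𝔬.Qstar U)
    (fun (y y' : g.Site) => B₄ * ((g.len y)⁻¹ * (vZ y' * g.len y')) * Real.exp (-(δ * g.dist y y')))
  dGQs : BlockBd (g := toB6 g R₀ H₀) 𝔬.blkZ 𝔬.blkY (𝔬.D U ∘ₗ 𝔬.G0 U ∘ₗ 𝔬.Qstar U)
    (fun (y y' : g.Site) => B₄ * (vZ y' * g.len y') * Real.exp (-(δ * g.dist y y')))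
  rgdI : BlockBd (g := toB6 g R₀ H₀) 𝔬.blk 𝔬.blkW (𝔬.R U ∘ₗ 𝔬.Dvstar U ∘ₗ 𝔬.G1 U ∘ₗ LinearMap.id)
    (fun (y y' : g.Site) => B₄ * g.len y' * Real.exp (-(δ * g.dist y y')))
  rgdDs : BlockBd (g := toB6 g R₀ H₀) 𝔬.blkY 𝔬.blkW (𝔬.R U ∘ₗ 𝔬.Dvstar U ∘ₗ 𝔬.G1 U ∘ₗ 𝔬.Dstar U)
    (fun (y y' : g.Site) => B₄ * Real.exp (-(δ * g.dist y y')))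
  rgdLap : BlockBd (g := toB6 g R₀ H₀) 𝔬.blk 𝔬.blkW (𝔬.R U ∘ₗ 𝔬.Dvstar U ∘ₗ 𝔬.G1 U ∘ₗ Lap U)
    (fun (y y' : g.Site) => B₄ * (g.len y')⁻¹ * Real.exp (-(δ * g.dist y y')))
  c1 : BlockBd (g := toB6 g R₀ H₀) 𝔬.blkZ 𝔬.blkZ (𝔬.C1 U)
    (fun (y y' : g.Site) => B₄ * (vZ y * g.len y)⁻¹ * (vZ y' * g.len y')⁻¹ * Real.exp (-(δ * g.dist y y')))
  q : BlockBd (g := toB6 g R₀ H₀) 𝔬.blk 𝔬.blkZ (𝔬.Q U)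
    (fun (y y' : g.Site) => B₄ * (vZ y * g.len y * (g.len y')⁻¹) * Real.exp (-(δ * g.dist y y')))

/-! ## §2 The three block-L² lines of 𝔊 = 𝔓G₁ over the re-weighted letters -/

/-- ★ (**Z-TWIN**, coarse block-L² classes re-weighted by the free `vZ` of `Letters313L2Z`; statement and proof otherwise verbatim) **(3.46)₄ FOR 𝔊 = 𝔓G₁ AS A BLOCK-L² BOUND** — ‖1_{Δ(y)}∇_U𝔊∇*_Uμ‖₂ ≦ K·e^{−ρd(y,y′)}‖μ‖₂ for supp μ ⊂ Δ(y′): (3.153) with E = ∇_U,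
F = ∇*_U (`E_GG_F_eq`), the G₁-entries ∇G₁∇*, ∇G₁D, ∇G₁Q*, G₁∇* by r1's Neumann bookkeeping from Theorem 3.3 for G₀ and the step
(`entry_l2w_of_step`), the letters RD*G₁∇*, C₁, Q (`Letters313L2`), composed by `hasMaj_frakG_classes` in the block-L² classes (all
cutting costs 1) with [4] (2.61) as the row sum; provisos ρ + 5σ ≦ δ, B₂θc² < 1; K = `constG46 (constKp B₂ B₄ θ c) c`.
[cite: Balaban1985BackgroundPropagators, Thm 3.13 p.426 + (3.153) p.426 + (3.46) p.398 + Thm 3.12 p.423; Balaban1984PropagatorsII, Lemma 2.1 (2.61) p.234] -/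
theorem GG_l2bd_entry4Z (hG : GeoOK g) {𝔬 : Ops g B X Y Z W} {Lap : B.Cfg → Module.End ℝ (X → ℝ)} {U : B.Cfg}
    {B₂ B₄ θ δ ρ σ c : ℝ} (hrow : RowSum (toB6 g R₀ H₀) σ c) (hB₂ : 0 ≤ B₂) (hB₄ : 0 ≤ B₄) (hθ : 0 ≤ θ) (hρ : 0 ≤ ρ)
    (hσ : 0 ≤ σ) (hρδ : ρ + 5 * σ ≤ δ) (hL : Thm33G0L2 𝔬 Lap R₀ H₀ B₂ δ U)
    (hT : BlockBd (g := toB6 g R₀ H₀) 𝔬.blk 𝔬.blk (𝔬.Tpi U + 𝔬.T2 U)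
      (fun (y y' : g.Site) => θ * (g.len y)⁻¹ * (g.len y')⁻¹ * Real.exp (-(δ * g.dist y y'))))
    {vZ : g.Site → ℝ} {hvZ : ∀ y, 0 < vZ y}
    (hLt : Letters313L2Z 𝔬 Lap R₀ H₀ B₄ δ vZ hvZ U) (hI : Identities 𝔬 U) (hq : B₂ * θ * c * c < 1) :
    BlockBd (g := toB6 g R₀ H₀) 𝔬.blkY 𝔬.blkY (𝔬.D U ∘ₗ (𝔬.GG U ∘ₗ 𝔬.Dstar U))
      (fun (y y' : g.Site) => constG46 (constKp B₂ B₄ θ c) c * Real.exp (-(ρ * g.dist y y'))) := by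
  have hc : 0 ≤ c ∨ IsEmpty g.Site := by
    by_cases hne : Nonempty g.Site
    · exact Or.inl (hrow.nonneg hne.some)
    · exact Or.inr (not_nonempty_iff.mp hne)
  rcases hc with hc | hemp
  swap
  · intro y' μ hμ y
    exact (hemp.false y).elim
  have htri : Triangle254 (toB6 g R₀ H₀) := fun a b c => hG.tri a b c
  have hW1 : ∀ y : g.Site, 0 < (fun _ : g.Site => (1 : ℝ)) y := fun _ => one_pos
  have hWl : ∀ y : g.Site, 0 < (fun y : g.Site => g.len y) y := fun y => hG.lenpos y
  have hWi : ∀ y : g.Site, 0 < (fun y : g.Site => (g.len y)⁻¹) y := fun y => inv_pos.mpr (hG.lenpos y)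
  have hWv : ∀ y : g.Site, 0 < (fun y : g.Site => vZ y * g.len y) y := fun y => mul_pos (hvZ y) (hG.lenpos y)
  have hWvi : ∀ y : g.Site, 0 < (fun y : g.Site => (vZ y * g.len y)⁻¹) y := fun y => inv_pos.mpr (mul_pos (hvZ y) (hG.lenpos y))
  have hfix : 𝔬.G1 U = 𝔬.G0 U + 𝔬.G0 U ∘ₗ (𝔬.Tpi U + 𝔬.T2 U) ∘ₗ 𝔬.G1 U := fix_of_inverses hI.invG0' hI.invG1
  -- constants
  have hS0 : 0 ≤ B₂ + B₄ := add_nonneg hB₂ hB₄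
  have hS₂ : B₂ ≤ B₂ + B₄ := by linarith
  have hS₄ : B₄ ≤ B₂ + B₄ := by linarith
  obtain ⟨hKp0, -⟩ := constP_nonneg_le hθ hc hq hS0 hS0 hS0 le_rfl le_rfl le_rfl
  obtain ⟨hP₂0, hP₂le⟩ := constP_nonneg_le hθ hc hq hB₂ hB₂ hB₂ hS₂ hS₂ hS₂
  obtain ⟨hP₄0, hP₄le⟩ := constP_nonneg_le hθ hc hq hB₄ hB₂ hB₄ hS₄ hS₂ hS₄
  have hB₄K : B₄ ≤ constP B₂ θ c (B₂ + B₄) (B₂ + B₄) (B₂ + B₄) := by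
    have hq1 : 0 ≤ (1 - B₂ * θ * c * c)⁻¹ := inv_nonneg.mpr (by linarith)
    have h0 : 0 ≤ (B₂ + B₄) * (θ * ((B₂ + B₄) * (1 - B₂ * θ * c * c)⁻¹) * c) * c :=
      mul_nonneg (mul_nonneg hS0 (mul_nonneg (mul_nonneg hθ (mul_nonneg hS0 hq1)) hc)) hc
    unfold constP; linarith
  have hKK0 : 0 ≤ constP B₂ θ c (B₂ + B₄) (B₂ + B₄) (B₂ + B₄) * constP B₂ θ c (B₂ + B₄) (B₂ + B₄) (B₂ + B₄) * c :=
    mul_nonneg (mul_nonneg hKp0 hKp0) hc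
  -- rates
  have hr₁0 : 0 ≤ ρ + 3 * σ := by linarith
  have hr₁δ : ρ + 3 * σ + 2 * σ ≤ δ := by linarith
  have hr₂0 : 0 ≤ ρ + 2 * σ := by linarith
  have hr₂1 : ρ + 2 * σ ≤ ρ + 3 * σ := by linarith
  have hr₂δ' : ρ + 2 * σ + σ ≤ δ := by linarith
  have hr₂δ : ρ + 2 * σ ≤ δ := by linarith
  have hρr₂ : ρ + 2 * σ ≤ ρ + 2 * σ := le_rfl
  -- the G₁-entries ∇G₁∇*, ∇G₁D, ∇G₁Q*, G₁∇* by r1's Neumann bookkeeping, at the rate ρ + 3σ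
  have pG := entry_l2w_of_step hG hW1 hW1 (Eop := 𝔬.D U) (Fop := 𝔬.Dstar U) (aS := B₂) (aE := B₂) (aEF := B₂) hrow hB₂ hθ
    hB₂ hB₂ hB₂ hr₁0 hσ hr₁δ hL hT (hL.l2.mono fun y y' => le_of_eq (by ring)) (hL.l1.mono fun y y' => le_of_eq (by ring))
    (hL.l4.mono fun y y' => le_of_eq (by ring)) hfix hq
  have pGD := entry_l2w_of_step hG hW1 hW1 (Eop := 𝔬.D U) (Fop := 𝔬.Dv U) (aS := B₄) (aE := B₂) (aEF := B₄) hrow hB₂ hθ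
    hB₄ hB₂ hB₄ hr₁0 hσ hr₁δ hL hT (hLt.gDv.mono fun y y' => le_of_eq (by ring)) (hL.l1.mono fun y y' => le_of_eq (by ring))
    (hLt.dGDv.mono fun y y' => le_of_eq (by ring)) hfix hq
  have pGQ := entry_l2w_of_step hG hWv hW1 (Eop := 𝔬.D U) (Fop := 𝔬.Qstar U) (aS := B₄) (aE := B₂) (aEF := B₄) hrow hB₂ hθ
    hB₄ hB₂ hB₄ hr₁0 hσ hr₁δ hL hT (hLt.gQs.mono fun y y' => le_of_eq (by ring)) (hL.l1.mono fun y y' => le_of_eq (by ring))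
    (hLt.dGQs.mono fun y y' => le_of_eq (by ring)) hfix hq
  have pGDs := entry_l2w_of_step hG hW1 hWi (Eop := LinearMap.id) (Fop := 𝔬.Dstar U) (aS := B₂) (aE := B₂) (aEF := B₂) hrow
    hB₂ hθ hB₂ hB₂ hB₂ hr₁0 hσ hr₁δ hL hT (hL.l2.mono fun y y' => le_of_eq (by ring))
    (by rw [LinearMap.id_comp]; exact hL.l0.mono fun y y' => le_of_eq (by rw [inv_inv]; ring))
    (by rw [LinearMap.id_comp]; exact hL.l2.mono fun y y' => le_of_eq (by rw [inv_inv]; ring)) hfix hq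
  rw [LinearMap.id_comp] at pGDs
  -- the letters RD*G₁∇*, C₁, Q in the block-L² classes
  have pRG : HasMaj (l2w (toB6 g R₀ H₀) 𝔬.blkY (fun _ : g.Site => (1 : ℝ)) fun y => (hW1 y).le)
      (l2w (toB6 g R₀ H₀) 𝔬.blkW (fun _ : g.Site => (1 : ℝ)) fun y => (hW1 y).le)
      (𝔬.R U ∘ₗ 𝔬.Dvstar U ∘ₗ 𝔬.G1 U ∘ₗ 𝔬.Dstar U) (fun y y' => B₄ * Real.exp (-(δ * g.dist y y'))) :=
    hasMaj_l2w_of_blockBd_ratio (g := toB6 g R₀ H₀) hW1 hW1 (hLt.rgdDs.mono fun y y' => le_of_eq (by ring))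
  have pC : HasMaj (l2w (toB6 g R₀ H₀) 𝔬.blkZ (fun y : g.Site => (vZ y * g.len y)⁻¹) fun y => (hWvi y).le)
      (l2w (toB6 g R₀ H₀) 𝔬.blkZ (fun y : g.Site => vZ y * g.len y) fun y => (hWv y).le)
      (𝔬.C1 U) (fun y y' => B₄ * Real.exp (-(δ * g.dist y y'))) :=
    hasMaj_l2w_of_blockBd_ratio (g := toB6 g R₀ H₀) hWvi hWv (hLt.c1.mono fun y y' => le_of_eq (by ring))
  have pQ : HasMaj (l2w (toB6 g R₀ H₀) 𝔬.blk (fun y : g.Site => (g.len y)⁻¹) fun y => (hWi y).le)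
      (l2w (toB6 g R₀ H₀) 𝔬.blkZ (fun y : g.Site => (vZ y * g.len y)⁻¹) fun y => (hWvi y).le)
      (𝔬.Q U) (fun y y' => B₄ * Real.exp (-(δ * g.dist y y'))) :=
    hasMaj_l2w_of_blockBd_ratio (g := toB6 g R₀ H₀) hWi hWvi (hLt.q.mono fun y y' => le_of_eq (by rw [inv_inv]; ring))
  -- QG₁∇* at the rate ρ + 2σ
  have pQG := hasMaj_comp_exp htri hG.dnn hrow hB₄ hP₂0 hr₂0 hr₂1 hr₂δ' pQ pGDs
  simp only [l2w_κ, one_mul] at pQG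
  -- everything at (K_p, ρ + 2σ), the composite at K_p²c
  have uG := hasMaj_up hG hP₂0 hP₂le hr₂1 pG
  have uGD := hasMaj_up hG hP₄0 hP₄le hr₂1 pGD
  have uRG := hasMaj_up hG hB₄ hB₄K hr₂δ pRG
  have uGQ := hasMaj_up hG hP₄0 hP₄le hr₂1 pGQ
  have uC := hasMaj_up hG hB₄ hB₄K hr₂δ pC
  have uQG := hasMaj_up hG (mul_nonneg (mul_nonneg hB₄ hP₂0) hc)
    (mul_le_mul_of_nonneg_right (mul_le_mul hB₄K hP₂le hP₂0 hKp0) hc) hρr₂ pQG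
  -- (3.153) composed in the block-L² classes
  have hfr := hasMaj_frakG_classes htri hG.dnn hrow hKp0 hKp0 hKp0 hKp0 hKp0 hKK0 hρ hσ hρr₂ uG uGD uRG uGQ uC uQG
  have hGG := hfr.congr (T' := 𝔬.D U ∘ₗ (𝔬.GG U ∘ₗ 𝔬.Dstar U)) fun μ => by rw [E_GG_F_eq hI (𝔬.D U) (𝔬.Dstar U)]
  have hbd := blockBd_of_hasMaj_l2w hGG hW1
  refine hbd.mono fun y y' => le_of_eq ?_
  simp only [l2w_κ, one_mul, toB6_dist, constG46, constKp, mul_one, div_one]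

/-- ★ (**Z-TWIN**, coarse block-L² classes re-weighted by the free `vZ` of `Letters313L2Z`; statement and proof otherwise verbatim) **(3.46)₃ FOR 𝔊 = 𝔓G₁ AS A BLOCK-L² BOUND** — ‖1_{Δ(y)}Δ_U𝔊λ‖₂ ≦ K·Λ·e^{−(ρ−αρ₀)d(y,y′)}‖λ‖₂ for supp λ ⊂ Δ(y′): (3.153) with E = Δ_U
(`E_GG_eq`), the G₁-entries Δ_UG₁, Δ_UG₁D, Δ_UG₁Q*, G₁ from Theorem 3.3 for G₀ and the step (`entry_l2w_of_step`), the letters RD*G₁,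
C₁, Q, composed by `hasMaj_frakG_classes` in the block-L² classes Lʲη → Lʲη (which carries the ratio L^{j′}η∕Lʲη), then the scale
transfer (2.60) of p. 398 (`blockBd_transfer`, constant Λ, rate loss αρ₀); provisos ρ + 5σ ≦ δ, B₂θc² < 1.
[cite: Balaban1985BackgroundPropagators, Thm 3.13 p.426 + (3.153) p.426 + (3.46) p.398 + p.398 (remark after (3.47)); Balaban1984PropagatorsII, Lemma 2.1 (2.60)–(2.61) p.234] -/
theorem GG_l2bd_entry3Z (hG : GeoOK g) {𝔬 : Ops g B X Y Z W} {Lap : B.Cfg → Module.End ℝ (X → ℝ)} {U : B.Cfg}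
    {B₂ B₄ θ δ ρ ρ₀ α Λ σ c : ℝ} (hrow : RowSum (toB6 g R₀ H₀) σ c) (hB₂ : 0 ≤ B₂) (hB₄ : 0 ≤ B₄) (hθ : 0 ≤ θ) (hρ : 0 ≤ ρ)
    (hσ : 0 ≤ σ) (hρδ : ρ + 5 * σ ≤ δ) (hST : ScaleTransfer g ρ₀ α Λ (fun y => g.len y ^ (1 : ℝ)))
    (hL : Thm33G0L2 𝔬 Lap R₀ H₀ B₂ δ U)
    (hT : BlockBd (g := toB6 g R₀ H₀) 𝔬.blk 𝔬.blk (𝔬.Tpi U + 𝔬.T2 U)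
      (fun (y y' : g.Site) => θ * (g.len y)⁻¹ * (g.len y')⁻¹ * Real.exp (-(δ * g.dist y y'))))
    {vZ : g.Site → ℝ} {hvZ : ∀ y, 0 < vZ y}
    (hLt : Letters313L2Z 𝔬 Lap R₀ H₀ B₄ δ vZ hvZ U) (hI : Identities 𝔬 U) (hq : B₂ * θ * c * c < 1) :
    BlockBd (g := toB6 g R₀ H₀) 𝔬.blk 𝔬.blk (Lap U ∘ₗ 𝔬.GG U)
      (fun (y y' : g.Site) => constG46 (constKp B₂ B₄ θ c) c * Λ * Real.exp (-((ρ - α * ρ₀) * g.dist y y'))) := by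
  have hc : 0 ≤ c ∨ IsEmpty g.Site := by
    by_cases hne : Nonempty g.Site
    · exact Or.inl (hrow.nonneg hne.some)
    · exact Or.inr (not_nonempty_iff.mp hne)
  rcases hc with hc | hemp
  swap
  · intro y' μ hμ y
    exact (hemp.false y).elim
  have htri : Triangle254 (toB6 g R₀ H₀) := fun a b c => hG.tri a b c
  have hW1 : ∀ y : g.Site, 0 < (fun _ : g.Site => (1 : ℝ)) y := fun _ => one_pos
  have hWl : ∀ y : g.Site, 0 < (fun y : g.Site => g.len y) y := fun y => hG.lenpos y
  have hWi : ∀ y : g.Site, 0 < (fun y : g.Site => (g.len y)⁻¹) y := fun y => inv_pos.mpr (hG.lenpos y)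
  have hWv : ∀ y : g.Site, 0 < (fun y : g.Site => vZ y * g.len y) y := fun y => mul_pos (hvZ y) (hG.lenpos y)
  have hWvi : ∀ y : g.Site, 0 < (fun y : g.Site => (vZ y * g.len y)⁻¹) y := fun y => inv_pos.mpr (mul_pos (hvZ y) (hG.lenpos y))
  have hfix : 𝔬.G1 U = 𝔬.G0 U + 𝔬.G0 U ∘ₗ (𝔬.Tpi U + 𝔬.T2 U) ∘ₗ 𝔬.G1 U := fix_of_inverses hI.invG0' hI.invG1
  -- constants
  have hS0 : 0 ≤ B₂ + B₄ := add_nonneg hB₂ hB₄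
  have hS₂ : B₂ ≤ B₂ + B₄ := by linarith
  have hS₄ : B₄ ≤ B₂ + B₄ := by linarith
  obtain ⟨hKp0, -⟩ := constP_nonneg_le hθ hc hq hS0 hS0 hS0 le_rfl le_rfl le_rfl
  obtain ⟨hP₂0, hP₂le⟩ := constP_nonneg_le hθ hc hq hB₂ hB₂ hB₂ hS₂ hS₂ hS₂
  obtain ⟨hP₄0, hP₄le⟩ := constP_nonneg_le hθ hc hq hB₄ hB₂ hB₄ hS₄ hS₂ hS₄
  have hB₄K : B₄ ≤ constP B₂ θ c (B₂ + B₄) (B₂ + B₄) (B₂ + B₄) := by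
    have hq1 : 0 ≤ (1 - B₂ * θ * c * c)⁻¹ := inv_nonneg.mpr (by linarith)
    have h0 : 0 ≤ (B₂ + B₄) * (θ * ((B₂ + B₄) * (1 - B₂ * θ * c * c)⁻¹) * c) * c :=
      mul_nonneg (mul_nonneg hS0 (mul_nonneg (mul_nonneg hθ (mul_nonneg hS0 hq1)) hc)) hc
    unfold constP; linarith
  have hKK0 : 0 ≤ constP B₂ θ c (B₂ + B₄) (B₂ + B₄) (B₂ + B₄) * constP B₂ θ c (B₂ + B₄) (B₂ + B₄) (B₂ + B₄) * c :=
    mul_nonneg (mul_nonneg hKp0 hKp0) hc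
  have hKG0 : 0 ≤ constG46 (constKp B₂ B₄ θ c) c := constG46_nonneg hKp0 hc
  -- rates
  have hr₁0 : 0 ≤ ρ + 3 * σ := by linarith
  have hr₁δ : ρ + 3 * σ + 2 * σ ≤ δ := by linarith
  have hr₂0 : 0 ≤ ρ + 2 * σ := by linarith
  have hr₂1 : ρ + 2 * σ ≤ ρ + 3 * σ := by linarith
  have hr₂δ' : ρ + 2 * σ + σ ≤ δ := by linarith
  have hr₂δ : ρ + 2 * σ ≤ δ := by linarith
  have hρr₂ : ρ + 2 * σ ≤ ρ + 2 * σ := le_rfl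
  -- the G₁-entries Δ_UG₁, Δ_UG₁D, Δ_UG₁Q*, G₁ by r1's Neumann bookkeeping, at the rate ρ + 3σ
  have pG := entry_l2w_of_step hG hWl hWl (Eop := Lap U) (Fop := LinearMap.id) (aS := B₂) (aE := B₂) (aEF := B₂) hrow hB₂
    hθ hB₂ hB₂ hB₂ hr₁0 hσ hr₁δ hL hT (by rw [LinearMap.comp_id]; exact hL.l0.mono fun y y' => le_of_eq (by ring))
    (hL.l3.mono fun y y' => le_of_eq (by ring))
    (by rw [LinearMap.comp_id]; exact hL.l3.mono fun y y' => le_of_eq (by ring)) hfix hq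
  have pGD := entry_l2w_of_step hG hW1 hWl (Eop := Lap U) (Fop := 𝔬.Dv U) (aS := B₄) (aE := B₂) (aEF := B₄) hrow hB₂ hθ
    hB₄ hB₂ hB₄ hr₁0 hσ hr₁δ hL hT (hLt.gDv.mono fun y y' => le_of_eq (by ring)) (hL.l3.mono fun y y' => le_of_eq (by ring))
    (hLt.lapGDv.mono fun y y' => le_of_eq (by ring)) hfix hq
  have pGQ := entry_l2w_of_step hG hWv hWl (Eop := Lap U) (Fop := 𝔬.Qstar U) (aS := B₄) (aE := B₂) (aEF := B₄) hrow hB₂ hθ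
    hB₄ hB₂ hB₄ hr₁0 hσ hr₁δ hL hT (hLt.gQs.mono fun y y' => le_of_eq (by ring)) (hL.l3.mono fun y y' => le_of_eq (by ring))
    (hLt.lapGQs.mono fun y y' => le_of_eq (by ring)) hfix hq
  have pG1 := entry_l2w_of_step hG hWl hWi (Eop := LinearMap.id) (Fop := LinearMap.id) (aS := B₂) (aE := B₂) (aEF := B₂)
    hrow hB₂ hθ hB₂ hB₂ hB₂ hr₁0 hσ hr₁δ hL hT
    (by rw [LinearMap.comp_id]; exact hL.l0.mono fun y y' => le_of_eq (by ring))
    (by rw [LinearMap.id_comp]; exact hL.l0.mono fun y y' => le_of_eq (by rw [inv_inv]; ring))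
    (by rw [LinearMap.id_comp, LinearMap.comp_id]; exact hL.l0.mono fun y y' => le_of_eq (by rw [inv_inv]; ring)) hfix hq
  rw [LinearMap.id_comp] at pG1
  -- the letters RD*G₁, C₁, Q in the block-L² classes
  have pRG : HasMaj (l2w (toB6 g R₀ H₀) 𝔬.blk (fun y : g.Site => g.len y) fun y => (hWl y).le)
      (l2w (toB6 g R₀ H₀) 𝔬.blkW (fun _ : g.Site => (1 : ℝ)) fun y => (hW1 y).le)
      (𝔬.R U ∘ₗ 𝔬.Dvstar U ∘ₗ 𝔬.G1 U ∘ₗ LinearMap.id) (fun y y' => B₄ * Real.exp (-(δ * g.dist y y'))) :=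
    hasMaj_l2w_of_blockBd_ratio (g := toB6 g R₀ H₀) hWl hW1 (hLt.rgdI.mono fun y y' => le_of_eq (by ring))
  have pC : HasMaj (l2w (toB6 g R₀ H₀) 𝔬.blkZ (fun y : g.Site => (vZ y * g.len y)⁻¹) fun y => (hWvi y).le)
      (l2w (toB6 g R₀ H₀) 𝔬.blkZ (fun y : g.Site => vZ y * g.len y) fun y => (hWv y).le)
      (𝔬.C1 U) (fun y y' => B₄ * Real.exp (-(δ * g.dist y y'))) :=
    hasMaj_l2w_of_blockBd_ratio (g := toB6 g R₀ H₀) hWvi hWv (hLt.c1.mono fun y y' => le_of_eq (by ring))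
  have pQ : HasMaj (l2w (toB6 g R₀ H₀) 𝔬.blk (fun y : g.Site => (g.len y)⁻¹) fun y => (hWi y).le)
      (l2w (toB6 g R₀ H₀) 𝔬.blkZ (fun y : g.Site => (vZ y * g.len y)⁻¹) fun y => (hWvi y).le)
      (𝔬.Q U) (fun y y' => B₄ * Real.exp (-(δ * g.dist y y'))) :=
    hasMaj_l2w_of_blockBd_ratio (g := toB6 g R₀ H₀) hWi hWvi (hLt.q.mono fun y y' => le_of_eq (by rw [inv_inv]; ring))
  -- QG₁ at the rate ρ + 2σ
  have pQG := hasMaj_comp_exp htri hG.dnn hrow hB₄ hP₂0 hr₂0 hr₂1 hr₂δ' pQ pG1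
  simp only [l2w_κ, one_mul] at pQG
  -- everything at (K_p, ρ + 2σ), the composite at K_p²c
  have uG := hasMaj_up hG hP₂0 hP₂le hr₂1 pG
  have uGD := hasMaj_up hG hP₄0 hP₄le hr₂1 pGD
  have uRG := hasMaj_up hG hB₄ hB₄K hr₂δ pRG
  have uGQ := hasMaj_up hG hP₄0 hP₄le hr₂1 pGQ
  have uC := hasMaj_up hG hB₄ hB₄K hr₂δ pC
  have uQG := hasMaj_up hG (mul_nonneg (mul_nonneg hB₄ hP₂0) hc)
    (mul_le_mul_of_nonneg_right (mul_le_mul hB₄K hP₂le hP₂0 hKp0) hc) hρr₂ pQG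
  -- (3.153) composed in the block-L² classes, then unweighted and transferred
  have hfr := hasMaj_frakG_classes htri hG.dnn hrow hKp0 hKp0 hKp0 hKp0 hKp0 hKK0 hρ hσ hρr₂ uG uGD uRG uGQ uC uQG
  have hGG := hfr.congr (T' := Lap U ∘ₗ 𝔬.GG U) fun μ => by rw [E_GG_eq hI (Lap U)]
  have hbd := blockBd_of_hasMaj_l2w hGG hWl
  have h' : BlockBd (g := toB6 g R₀ H₀) 𝔬.blk 𝔬.blk (Lap U ∘ₗ 𝔬.GG U)
      (fun (y y' : g.Site) => constG46 (constKp B₂ B₄ θ c) c * (g.len y' ^ (1 : ℝ) * (g.len y ^ (1 : ℝ))⁻¹) *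
        Real.exp (-(ρ * g.dist y y'))) :=
    hbd.mono fun y y' => le_of_eq (by
      simp only [l2w_κ, one_mul, toB6_dist, constG46, constKp, Real.rpow_one, div_eq_mul_inv]; ring)
  exact blockBd_transfer (C := fun _ _ => constG46 (constKp B₂ B₄ θ c) c) (fun _ _ => hKG0)
    (fun z => Real.rpow_pos_of_pos (hG.lenpos z) 1) hST h'

/-- ★ (**Z-TWIN**, coarse block-L² classes re-weighted by the free `vZ` of `Letters313L2Z`; statement and proof otherwise verbatim) **(3.46)₅ FOR 𝔊 = 𝔓G₁ AS A BLOCK-L² BOUND** — ‖1_{Δ(y)}𝔊Δ_Uλ‖₂ ≦ K·Λ′·e^{−(ρ−αρ₀)d(y,y′)}‖λ‖₂ for supp λ ⊂ Δ(y′): (3.153) with F = Δ_U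
(`B9Thm313Whole.GG_comp_eq`), the G₁-entries G₁Δ_U, G₁D, G₁Q* from Theorem 3.3 for G₀ and the step (`entry_l2w_of_step`), the letters
RD*G₁Δ_U, C₁, Q, composed by `hasMaj_frakG_classes` in the block-L² classes (Lʲη)⁻¹ → (Lʲη)⁻¹ (which carries the ratio Lʲη∕L^{j′}η), then
the scale transfer (2.60) at the weight (Lʲη)⁻¹ (constant Λ′, rate loss αρ₀); provisos ρ + 5σ ≦ δ, B₂θc² < 1.
[cite: Balaban1985BackgroundPropagators, Thm 3.13 p.426 + (3.153) p.426 + (3.46) p.398 + p.398 (remark after (3.47)); Balaban1984PropagatorsII, Lemma 2.1 (2.60)–(2.61) p.234] -/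
theorem GG_l2bd_entry5Z (hG : GeoOK g) {𝔬 : Ops g B X Y Z W} {Lap : B.Cfg → Module.End ℝ (X → ℝ)} {U : B.Cfg}
    {B₂ B₄ θ δ ρ ρ₀ α Λ σ c : ℝ} (hrow : RowSum (toB6 g R₀ H₀) σ c) (hB₂ : 0 ≤ B₂) (hB₄ : 0 ≤ B₄) (hθ : 0 ≤ θ) (hρ : 0 ≤ ρ)
    (hσ : 0 ≤ σ) (hρδ : ρ + 5 * σ ≤ δ) (hST : ScaleTransfer g ρ₀ α Λ (fun y => g.len y ^ (-1 : ℝ)))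
    (hL : Thm33G0L2 𝔬 Lap R₀ H₀ B₂ δ U)
    (hT : BlockBd (g := toB6 g R₀ H₀) 𝔬.blk 𝔬.blk (𝔬.Tpi U + 𝔬.T2 U)
      (fun (y y' : g.Site) => θ * (g.len y)⁻¹ * (g.len y')⁻¹ * Real.exp (-(δ * g.dist y y'))))
    {vZ : g.Site → ℝ} {hvZ : ∀ y, 0 < vZ y}
    (hLt : Letters313L2Z 𝔬 Lap R₀ H₀ B₄ δ vZ hvZ U) (hI : Identities 𝔬 U) (hq : B₂ * θ * c * c < 1) :
    BlockBd (g := toB6 g R₀ H₀) 𝔬.blk 𝔬.blk (𝔬.GG U ∘ₗ Lap U)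
      (fun (y y' : g.Site) => constG46 (constKp B₂ B₄ θ c) c * Λ * Real.exp (-((ρ - α * ρ₀) * g.dist y y'))) := by
  have hc : 0 ≤ c ∨ IsEmpty g.Site := by
    by_cases hne : Nonempty g.Site
    · exact Or.inl (hrow.nonneg hne.some)
    · exact Or.inr (not_nonempty_iff.mp hne)
  rcases hc with hc | hemp
  swap
  · intro y' μ hμ y
    exact (hemp.false y).elim
  have htri : Triangle254 (toB6 g R₀ H₀) := fun a b c => hG.tri a b c
  have hW1 : ∀ y : g.Site, 0 < (fun _ : g.Site => (1 : ℝ)) y := fun _ => one_pos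
  have hWl : ∀ y : g.Site, 0 < (fun y : g.Site => g.len y) y := fun y => hG.lenpos y
  have hWi : ∀ y : g.Site, 0 < (fun y : g.Site => (g.len y)⁻¹) y := fun y => inv_pos.mpr (hG.lenpos y)
  have hWv : ∀ y : g.Site, 0 < (fun y : g.Site => vZ y * g.len y) y := fun y => mul_pos (hvZ y) (hG.lenpos y)
  have hWvi : ∀ y : g.Site, 0 < (fun y : g.Site => (vZ y * g.len y)⁻¹) y := fun y => inv_pos.mpr (mul_pos (hvZ y) (hG.lenpos y))
  have hfix : 𝔬.G1 U = 𝔬.G0 U + 𝔬.G0 U ∘ₗ (𝔬.Tpi U + 𝔬.T2 U) ∘ₗ 𝔬.G1 U := fix_of_inverses hI.invG0' hI.invG1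
  -- constants
  have hS0 : 0 ≤ B₂ + B₄ := add_nonneg hB₂ hB₄
  have hS₂ : B₂ ≤ B₂ + B₄ := by linarith
  have hS₄ : B₄ ≤ B₂ + B₄ := by linarith
  obtain ⟨hKp0, -⟩ := constP_nonneg_le hθ hc hq hS0 hS0 hS0 le_rfl le_rfl le_rfl
  obtain ⟨hP₂0, hP₂le⟩ := constP_nonneg_le hθ hc hq hB₂ hB₂ hB₂ hS₂ hS₂ hS₂
  obtain ⟨hP₄0, hP₄le⟩ := constP_nonneg_le hθ hc hq hB₄ hB₂ hB₄ hS₄ hS₂ hS₄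
  have hB₄K : B₄ ≤ constP B₂ θ c (B₂ + B₄) (B₂ + B₄) (B₂ + B₄) := by
    have hq1 : 0 ≤ (1 - B₂ * θ * c * c)⁻¹ := inv_nonneg.mpr (by linarith)
    have h0 : 0 ≤ (B₂ + B₄) * (θ * ((B₂ + B₄) * (1 - B₂ * θ * c * c)⁻¹) * c) * c :=
      mul_nonneg (mul_nonneg hS0 (mul_nonneg (mul_nonneg hθ (mul_nonneg hS0 hq1)) hc)) hc
    unfold constP; linarith
  have hKK0 : 0 ≤ constP B₂ θ c (B₂ + B₄) (B₂ + B₄) (B₂ + B₄) * constP B₂ θ c (B₂ + B₄) (B₂ + B₄) (B₂ + B₄) * c :=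
    mul_nonneg (mul_nonneg hKp0 hKp0) hc
  have hKG0 : 0 ≤ constG46 (constKp B₂ B₄ θ c) c := constG46_nonneg hKp0 hc
  -- rates
  have hr₁0 : 0 ≤ ρ + 3 * σ := by linarith
  have hr₁δ : ρ + 3 * σ + 2 * σ ≤ δ := by linarith
  have hr₂0 : 0 ≤ ρ + 2 * σ := by linarith
  have hr₂1 : ρ + 2 * σ ≤ ρ + 3 * σ := by linarith
  have hr₂δ' : ρ + 2 * σ + σ ≤ δ := by linarith
  have hr₂δ : ρ + 2 * σ ≤ δ := by linarith
  have hρr₂ : ρ + 2 * σ ≤ ρ + 2 * σ := le_rfl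
  -- the G₁-entries G₁Δ_U, G₁D, G₁Q* by r1's Neumann bookkeeping, at the rate ρ + 3σ
  have pG := entry_l2w_of_step hG hWi hWi (Eop := LinearMap.id) (Fop := Lap U) (aS := B₂) (aE := B₂) (aEF := B₂) hrow hB₂
    hθ hB₂ hB₂ hB₂ hr₁0 hσ hr₁δ hL hT (hL.l5.mono fun y y' => le_of_eq (by ring))
    (by rw [LinearMap.id_comp]; exact hL.l0.mono fun y y' => le_of_eq (by rw [inv_inv]; ring))
    (by rw [LinearMap.id_comp]; exact hL.l5.mono fun y y' => le_of_eq (by rw [inv_inv]; ring)) hfix hq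
  rw [LinearMap.id_comp] at pG
  have pGD := entry_l2w_of_step hG hW1 hWi (Eop := LinearMap.id) (Fop := 𝔬.Dv U) (aS := B₄) (aE := B₂) (aEF := B₄) hrow
    hB₂ hθ hB₄ hB₂ hB₄ hr₁0 hσ hr₁δ hL hT (hLt.gDv.mono fun y y' => le_of_eq (by ring))
    (by rw [LinearMap.id_comp]; exact hL.l0.mono fun y y' => le_of_eq (by rw [inv_inv]; ring))
    (by rw [LinearMap.id_comp]; exact hLt.gDv.mono fun y y' => le_of_eq (by rw [inv_inv]; ring)) hfix hq
  rw [LinearMap.id_comp] at pGD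
  have pGQ := entry_l2w_of_step hG hWv hWi (Eop := LinearMap.id) (Fop := 𝔬.Qstar U) (aS := B₄) (aE := B₂) (aEF := B₄) hrow
    hB₂ hθ hB₄ hB₂ hB₄ hr₁0 hσ hr₁δ hL hT (hLt.gQs.mono fun y y' => le_of_eq (by ring))
    (by rw [LinearMap.id_comp]; exact hL.l0.mono fun y y' => le_of_eq (by rw [inv_inv]; ring))
    (by rw [LinearMap.id_comp]; exact hLt.gQs.mono fun y y' => le_of_eq (by rw [inv_inv]; ring)) hfix hq
  rw [LinearMap.id_comp] at pGQ
  -- the letters RD*G₁Δ_U, C₁, Q in the block-L² classes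
  have pRG : HasMaj (l2w (toB6 g R₀ H₀) 𝔬.blk (fun y : g.Site => (g.len y)⁻¹) fun y => (hWi y).le)
      (l2w (toB6 g R₀ H₀) 𝔬.blkW (fun _ : g.Site => (1 : ℝ)) fun y => (hW1 y).le)
      (𝔬.R U ∘ₗ 𝔬.Dvstar U ∘ₗ 𝔬.G1 U ∘ₗ Lap U) (fun y y' => B₄ * Real.exp (-(δ * g.dist y y'))) :=
    hasMaj_l2w_of_blockBd_ratio (g := toB6 g R₀ H₀) hWi hW1 (hLt.rgdLap.mono fun y y' => le_of_eq (by ring))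
  have pC : HasMaj (l2w (toB6 g R₀ H₀) 𝔬.blkZ (fun y : g.Site => (vZ y * g.len y)⁻¹) fun y => (hWvi y).le)
      (l2w (toB6 g R₀ H₀) 𝔬.blkZ (fun y : g.Site => vZ y * g.len y) fun y => (hWv y).le)
      (𝔬.C1 U) (fun y y' => B₄ * Real.exp (-(δ * g.dist y y'))) :=
    hasMaj_l2w_of_blockBd_ratio (g := toB6 g R₀ H₀) hWvi hWv (hLt.c1.mono fun y y' => le_of_eq (by ring))
  have pQ : HasMaj (l2w (toB6 g R₀ H₀) 𝔬.blk (fun y : g.Site => (g.len y)⁻¹) fun y => (hWi y).le)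
      (l2w (toB6 g R₀ H₀) 𝔬.blkZ (fun y : g.Site => (vZ y * g.len y)⁻¹) fun y => (hWvi y).le)
      (𝔬.Q U) (fun y y' => B₄ * Real.exp (-(δ * g.dist y y'))) :=
    hasMaj_l2w_of_blockBd_ratio (g := toB6 g R₀ H₀) hWi hWvi (hLt.q.mono fun y y' => le_of_eq (by rw [inv_inv]; ring))
  -- QG₁Δ_U at the rate ρ + 2σ
  have pQG := hasMaj_comp_exp htri hG.dnn hrow hB₄ hP₂0 hr₂0 hr₂1 hr₂δ' pQ pG
  simp only [l2w_κ, one_mul] at pQG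
  -- everything at (K_p, ρ + 2σ), the composite at K_p²c
  have uG := hasMaj_up hG hP₂0 hP₂le hr₂1 pG
  have uGD := hasMaj_up hG hP₄0 hP₄le hr₂1 pGD
  have uRG := hasMaj_up hG hB₄ hB₄K hr₂δ pRG
  have uGQ := hasMaj_up hG hP₄0 hP₄le hr₂1 pGQ
  have uC := hasMaj_up hG hB₄ hB₄K hr₂δ pC
  have uQG := hasMaj_up hG (mul_nonneg (mul_nonneg hB₄ hP₂0) hc)
    (mul_le_mul_of_nonneg_right (mul_le_mul hB₄K hP₂le hP₂0 hKp0) hc) hρr₂ pQG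
  -- (3.153) composed in the block-L² classes, then unweighted and transferred
  have hfr := hasMaj_frakG_classes htri hG.dnn hrow hKp0 hKp0 hKp0 hKp0 hKp0 hKK0 hρ hσ hρr₂ uG uGD uRG uGQ uC uQG
  have hGG := hfr.congr (T' := 𝔬.GG U ∘ₗ Lap U) fun μ => by rw [GG_comp_eq hI (Lap U)]
  have hbd := blockBd_of_hasMaj_l2w hGG hWi
  have h' : BlockBd (g := toB6 g R₀ H₀) 𝔬.blk 𝔬.blk (𝔬.GG U ∘ₗ Lap U)
      (fun (y y' : g.Site) => constG46 (constKp B₂ B₄ θ c) c * (g.len y' ^ (-1 : ℝ) * (g.len y ^ (-1 : ℝ))⁻¹) *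
        Real.exp (-(ρ * g.dist y y'))) :=
    hbd.mono fun y y' => le_of_eq (by
      simp only [l2w_κ, one_mul, toB6_dist, constG46, constKp, Real.rpow_neg_one, div_eq_mul_inv]; ring)
  exact blockBd_transfer (C := fun _ _ => constG46 (constKp B₂ B₄ θ c) c) (fun _ _ => hKG0)
    (fun z => Real.rpow_pos_of_pos (hG.lenpos z) (-1)) hST h'

end L2G

end

end Literature.MathematicalPhysics.QuantumFieldTheory.Balaban1983to89.B9Thm313WholeL2GZ
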